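import Mathlib
import HarnessLib
import Summits.MatrixMultiplication.MatrixMultiplication.Theorems.OutsiderSandwichBlockOneWorlds
import Summits.MatrixMultiplication.MatrixMultiplication.Theorems.OutsiderSandwichSquaredLaserPacking
import Summits.MatrixMultiplication.MatrixMultiplication.Theorems.OutsiderSandwichBlockOneRank
import Summits.MatrixMultiplication.MatrixMultiplication.Theorems.OutsiderSandwichBlockSubrank
import Summits.MatrixMultiplication.MatrixMultiplication.Theorems.OutsiderSandwichCouplingBenchmark
import Summits.MatrixMultiplication.MatrixMultiplication.Theorems.OutsiderSandwichLaserFloorCut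
import Summits.MatrixMultiplication.MatrixMultiplication.Theorems.OutsiderSandwichLaserFloorTop
import Summits.MatrixMultiplication.MatrixMultiplication.Theorems.OutsiderSandwichSpectralConverse

/-!
# OutsiderSandwich — the worlds are faithful (decomp-mm lens-4, g18)

Companion of `Theorems/OutsiderSandwichBlockOneWorlds.lean`.  The TRUE value set
`V = {(F⟨2,2,2⟩, F(cw₂), F(C₁), F(C₂), F(C₃)) : F a universal spectral point of ℂ}` satisfies the
laws L1–L9 (`laws_valueSet`, each law a tree theorem: `two_le_matExp`/`matExp_le_three`,
`three_le_map_cwTensor` + `R(cw₂) ≤ 4` (Conner–Huang–Landsberg), `laserFloor_mul`, `blockSubrankFull_holds` +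
`R̃(C₁) ≤ 7`, `map_coupling_le`, `couplingBenchmark_holds`, the g18 squared laser floor,
`isUniversal_rotatePoint`, `exists_top_point`), and the world letters evaluated at `V` ARE the route
items: `summitW_iff` (`ω = 2`), `blockOneMergeOptimalW_iff` (item 27149), `couplingMergeOptimalW_iff`
(item 28193), `laserMergeOptimal_iff_world` (residual of record 27897, through `LaserCutIsSpectral`).

Consequently (`residual_chain_strict`): the residual chain
`LaserMergeOptimal ⟹ CouplingMergeOptimal ⟹ BlockOneMergeOptimal` is PROVED, and by the typed models
`worldOne` / `worldTwo` neither converse is derivable from L1–L9 — the one-block residual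
`BlockOneMergeOptimal` is the finest typed residual of the lineage.

References: [Strassen1988, Thm. 3.8]; [CoppersmithWinograd1990, §7]; [ConnerHuangLandsberg2020, §1];
[BurgisserClausenShokrollahi1997, Thm. 15.41].
-/

noncomputable section

open Literature.Computability.AlgebraicComplexity
open Summit.MatrixMultiplication.MatrixMultiplication.Theorems.OutsiderSandwichBlockOneWorlds
open Summit.MatrixMultiplication.MatrixMultiplication.Theorems.OutsiderSandwichCoupling
  (coupling₁ coupling₂ coupling₃ couplingTensor map_coupling_le map_couplingTensor
    squaredLaserFloor_of_packing)
open Summit.MatrixMultiplication.MatrixMultiplication.Theorems.OutsiderSandwichBlockOne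
  (rotatePoint rotatePoint_apply isUniversal_rotatePoint rotatePoint_matMul map_coupling₂ map_coupling₃)
open Summit.MatrixMultiplication.MatrixMultiplication.Theorems.OutsiderSandwichLaserFloor
  (two_le_matExp laserFloor_mul)
open Summit.MatrixMultiplication.MatrixMultiplication.Theorems.OutsiderSandwichLaserFloorCut
  (matExp_le_omega matExp_le_three three_le_map_cwTensor)
open Summit.MatrixMultiplication.MatrixMultiplication.Theorems.OutsiderSandwichLaserFloorTop
  (exists_top_point)
open Summit.MatrixMultiplication.MatrixMultiplication.Theorems.OutsiderSandwichSpectralConverse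
  (map_matMulTensor_two_eq laserMergeOptimal_iff_tightAtTop)

namespace Summit.MatrixMultiplication.MatrixMultiplication.Theorems.OutsiderSandwichBlockOneWorldsFaithful

/-! ## 1. The true value set -/

/-- The value tuple of a spectral point. -/
def vals (F : SpectralMap ℂ) : Pt :=
  ⟨F (matMulTensor ℂ 2 2 2), F (cwTensor ℂ 2), F coupling₁, F coupling₂, F coupling₃⟩

/-- The true value set `V`. -/
def valueSet : Set Pt := {v | ∃ F : SpectralMap ℂ, IsUniversalSpectralPoint ℂ F ∧ v = vals F}

variable {F : SpectralMap ℂ}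

/-- `cw₂` is cyclically symmetric. -/
theorem rotate_cwTensor_two : rotate (cwTensor ℂ 2) = cwTensor ℂ 2 := by
  funext b c a
  simp only [rotate_apply, cwTensor_apply]
  fin_cases a <;> fin_cases b <;> fin_cases c <;> simp

/-- The value tuple of the rotated point is the rotated value tuple. -/
theorem vals_rotatePoint (hF : IsUniversalSpectralPoint ℂ F) : vals (rotatePoint F) = (vals F).rot := by
  have h1 : rotatePoint F coupling₁ = F coupling₃ := (map_coupling₃ F).symm
  have h2 : rotatePoint F coupling₂ = F coupling₁ := by
    rw [rotatePoint_apply, OutsiderSandwichCouplingBenchmark.coupling₂_eq_rotate_rotate]; rfl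
  have h3 : rotatePoint F coupling₃ = F coupling₂ := by
    rw [rotatePoint_apply, OutsiderSandwichCouplingBenchmark.coupling₃_eq_rotate, map_coupling₂ F,
      rotatePoint_apply, rotatePoint_apply]
  have h4 : rotatePoint F (cwTensor ℂ 2) = F (cwTensor ℂ 2) := by
    rw [rotatePoint_apply, rotate_cwTensor_two]
  simp only [vals, Pt.rot, rotatePoint_matMul hF, h1, h2, h3, h4]

/-- Monotonicity transfer: `log₂ G⟨2,2,2⟩ ≤ log₂ F⟨2,2,2⟩ ↔ G⟨2,2,2⟩ ≤ F⟨2,2,2⟩`. -/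
theorem logb_mm_le_iff {G : SpectralMap ℂ} (hG : IsUniversalSpectralPoint ℂ G)
    (hF : IsUniversalSpectralPoint ℂ F) :
    Real.logb 2 (G (matMulTensor ℂ 2 2 2)) ≤ Real.logb 2 (F (matMulTensor ℂ 2 2 2)) ↔
      G (matMulTensor ℂ 2 2 2) ≤ F (matMulTensor ℂ 2 2 2) :=
  Real.logb_le_logb one_lt_two (OutsiderSandwichBlock.map_matMulTensor_pos hG)
    (OutsiderSandwichBlock.map_matMulTensor_pos hF)

/-! ## 2. The true value set satisfies the laws -/

/-- **L1–L9 hold for the true value set.** -/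
theorem laws_valueSet : Laws valueSet where
  m_mem := by
    rintro v ⟨F, hF, rfl⟩
    have e := map_matMulTensor_two_eq hF
    have h2 : (2 : ℝ) ^ (2 : ℝ) ≤ (2 : ℝ) ^ Real.logb 2 (F (matMulTensor ℂ 2 2 2)) :=
      Real.rpow_le_rpow_of_exponent_le one_le_two (two_le_matExp hF)
    have h3 : (2 : ℝ) ^ Real.logb 2 (F (matMulTensor ℂ 2 2 2)) ≤ (2 : ℝ) ^ (3 : ℝ) :=
      Real.rpow_le_rpow_of_exponent_le one_le_two (matExp_le_three hF)
    rw [← e] at h2 h3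
    have e2 : (2 : ℝ) ^ (2 : ℝ) = 4 := by norm_num
    have e3 : (2 : ℝ) ^ (3 : ℝ) = 8 := by norm_num
    rw [e2] at h2; rw [e3] at h3
    exact ⟨h2, h3⟩
  f_mem := by
    rintro v ⟨F, hF, rfl⟩
    refine ⟨three_le_map_cwTensor hF, ?_⟩
    -- `R(cw₂) ≤ 4` over `ℂ`: the point `s = (1,1,1)` of the Conner–Huang–Landsberg torus family,
    -- `8·cw₂ = (1,2,0)^{⊗3} − (1,0,2i)^{⊗3} − (1,0,−2i)^{⊗3} + (1,−2,0)^{⊗3}` (a local copy: the landed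
    -- statement lives in a module without farm olean) [cite: ConnerHuangLandsberg2020, §1]
    have hR : tensorRank (cwTensor ℂ 2) ≤ 4 := by
      refine tensorRank_le_of_eq_sum
        (fun e a => (![1 / 8, -1 / 8, -1 / 8, 1 / 8] : Fin 4 → ℂ) e *
          (![![1, 2, 0], ![1, 0, 2 * Complex.I], ![1, 0, -2 * Complex.I], ![1, -2, 0]] :
            Fin 4 → Fin 3 → ℂ) e a)
        (![![1, 2, 0], ![1, 0, 2 * Complex.I], ![1, 0, -2 * Complex.I], ![1, -2, 0]] :
          Fin 4 → Fin 3 → ℂ)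
        (![![1, 2, 0], ![1, 0, 2 * Complex.I], ![1, 0, -2 * Complex.I], ![1, -2, 0]] :
          Fin 4 → Fin 3 → ℂ) ?_
      funext a b c
      simp only [Finset.sum_apply, Fin.sum_univ_four, triad, cwTensor_apply]
      fin_cases a <;> fin_cases b <;> fin_cases c <;> simp <;>
        first
          | ring1
          | linear_combination Complex.I_sq
    -- hence `F(cw₂) ≤ R̃(cw₂) ≤ R(cw₂) ≤ 4`
    show F (cwTensor ℂ 2) ≤ 4
    exact ((strassen_duality_asymptoticRank_holds ℂ (cwTensor ℂ 2)).1 F hF).trans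
      ((asymptoticRank_le_tensorRank (cwTensor ℂ 2)).trans (by exact_mod_cast hR))
  laser_floor := by
    rintro v ⟨F, hF, rfl⟩
    have h := laserFloor_mul hF
    have e := map_matMulTensor_two_eq hF
    set τ := Real.logb 2 (F (matMulTensor ℂ 2 2 2)) with hτ
    have ha : 0 ≤ (3 : ℝ) * (2 : ℝ) ^ ((τ - 2) / 3) := by positivity
    have h3 := pow_le_pow_left₀ ha h 3
    have hcube : ((3 : ℝ) * (2 : ℝ) ^ ((τ - 2) / 3)) ^ 3 = 27 * F (matMulTensor ℂ 2 2 2) / 4 := by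
      rw [mul_pow, ← Real.rpow_natCast ((2 : ℝ) ^ ((τ - 2) / 3)) 3, ← Real.rpow_mul (by norm_num),
        show (τ - 2) / 3 * ((3 : ℕ) : ℝ) = τ - 2 by push_cast; ring, Real.rpow_sub two_pos, ← e,
        show (2 : ℝ) ^ (2 : ℝ) = 4 by norm_num]
      ring
    rw [hcube] at h3
    show 27 * F (matMulTensor ℂ 2 2 2) ≤ 4 * F (cwTensor ℂ 2) ^ 3
    linarith
  c_mem := by
    rintro v ⟨F, hF, rfl⟩
    obtain ⟨h1, h2, h3⟩ := OutsiderSandwichBlockSubrank.blockSubrankFull_holds F hF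
    have u1 : F coupling₁ ≤ 7 :=
      ((strassen_duality_asymptoticRank_holds ℂ coupling₁).1 F hF).trans
        OutsiderSandwichBlockOneRank.asymptoticRank_coupling₁_le_seven
    have u2 : F coupling₂ ≤ 7 := by
      have h := (strassen_duality_asymptoticRank_holds ℂ coupling₂).1 F hF
      rw [OutsiderSandwichCouplingBenchmark.asymptoticRank_coupling₂] at h
      exact h.trans OutsiderSandwichBlockOneRank.asymptoticRank_coupling₁_le_seven
    have u3 : F coupling₃ ≤ 7 := by
      have h := (strassen_duality_asymptoticRank_holds ℂ coupling₃).1 F hF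
      rw [OutsiderSandwichCouplingBenchmark.asymptoticRank_coupling₃] at h
      exact h.trans OutsiderSandwichBlockOneRank.asymptoticRank_coupling₁_le_seven
    exact ⟨⟨h1, u1⟩, ⟨h2, u2⟩, ⟨h3, u3⟩⟩
  c_le_sq := by
    rintro v ⟨F, hF, rfl⟩
    exact map_coupling_le hF
  benchmark := by
    rintro v ⟨F, hF, rfl⟩
    have h := OutsiderSandwichCouplingBenchmark.couplingBenchmark_holds F hF
    rw [map_couplingTensor hF] at h
    exact h
  squared_floor := by
    rintro v ⟨F, hF, rfl⟩
    have h := squaredLaserFloor_of_packing OutsiderSandwichSquaredLaserPacking.squaredLaserPacking F hF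
    rw [map_couplingTensor hF] at h
    exact h
  rot_mem := by
    rintro v ⟨F, hF, rfl⟩
    exact ⟨rotatePoint F, isUniversal_rotatePoint hF, (vals_rotatePoint hF).symm⟩
  top_exists := by
    obtain ⟨G, hG, hGω⟩ := exists_top_point
    refine ⟨vals G, ⟨G, hG, rfl⟩, ?_⟩
    rintro w ⟨F, hF, rfl⟩
    show F (matMulTensor ℂ 2 2 2) ≤ G (matMulTensor ℂ 2 2 2)
    rw [← logb_mm_le_iff hF hG, hGω]
    exact matExp_le_omega hF

/-! ## 3. The letters at the true value set are the route items -/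

/-- A universal point is a top point of `V` iff it attains `ω`. -/
theorem isTop_vals_iff (hF : IsUniversalSpectralPoint ℂ F) :
    IsTop valueSet (vals F) ↔ Real.logb 2 (F (matMulTensor ℂ 2 2 2)) = omega ℂ := by
  constructor
  · rintro ⟨-, htop⟩
    refine le_antisymm (matExp_le_omega hF) ?_
    obtain ⟨G, hG, hGω⟩ := exists_top_point
    rw [← hGω, logb_mm_le_iff hG hF]
    exact htop (vals G) ⟨G, hG, rfl⟩
  · intro hω
    refine ⟨⟨F, hF, rfl⟩, ?_⟩
    rintro w ⟨G, hG, rfl⟩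
    show G (matMulTensor ℂ 2 2 2) ≤ F (matMulTensor ℂ 2 2 2)
    rw [← logb_mm_le_iff hG hF, hω]
    exact matExp_le_omega hG

/-- **`SummitW V ⟺ ω = 2`.** -/
theorem summitW_iff : SummitW valueSet ↔ _root_.MatrixMultiplication := by
  constructor
  · intro h
    obtain ⟨G, hG, hGω⟩ := exists_top_point
    exact OutsiderSandwichBlock.summit_of_top_le_four hG hGω (h (vals G) ⟨G, hG, rfl⟩)
  · rintro hS v ⟨F, hF, rfl⟩
    refine OutsiderSandwichBlock.map_matMulTensor_le_four_of_matExp_le_two hF ?_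
    have h := matExp_le_omega hF
    rw [(_root_.MatrixMultiplication_iff).1 hS] at h
    exact h

/-- **`BlockOneMergeOptimalW V ⟺ BlockOneMergeOptimal`** (item 27149). -/
theorem blockOneMergeOptimalW_iff :
    BlockOneMergeOptimalW valueSet ↔ Theses.OutsiderSandwich.BlockOneMergeOptimal := by
  rw [OutsiderSandwichBlockOneItems.blockOneMergeOptimal_iff]
  constructor
  · rintro ⟨v, ⟨⟨F, hF, rfl⟩, htop⟩, hle⟩
    exact ⟨F, hF, (isTop_vals_iff hF).1 ⟨⟨F, hF, rfl⟩, htop⟩, hle⟩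
  · rintro ⟨F, hF, hω, hle⟩
    exact ⟨vals F, (isTop_vals_iff hF).2 hω, hle⟩

/-- **`CouplingMergeOptimalW V ⟺ CouplingMergeOptimal`** (item 28193). -/
theorem couplingMergeOptimalW_iff :
    CouplingMergeOptimalW valueSet ↔ Theses.OutsiderSandwich.CouplingMergeOptimal := by
  rw [OutsiderSandwichCouplingItems.couplingMergeOptimal_iff]
  constructor
  · rintro ⟨v, ⟨⟨F, hF, rfl⟩, htop⟩, hle⟩
    refine ⟨F, hF, (isTop_vals_iff hF).1 ⟨⟨F, hF, rfl⟩, htop⟩, ?_⟩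
    rw [map_couplingTensor hF]; exact hle
  · rintro ⟨F, hF, hω, hle⟩
    refine ⟨vals F, (isTop_vals_iff hF).2 hω, ?_⟩
    rw [map_couplingTensor hF] at hle; exact hle

/-- **`LaserTightAtTopW V ⟺ LaserTightAtTop`.** -/
theorem laserTightAtTopW_iff :
    LaserTightAtTopW valueSet ↔ Theses.OutsiderSandwich.LaserTightAtTop := by
  constructor
  · intro h δ hδ
    obtain ⟨v, ⟨F, hF, rfl⟩, hnear, hfloor⟩ := h δ hδ
    exact ⟨F, hF, fun G hG => hnear (vals G) ⟨G, hG, rfl⟩, hfloor⟩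
  · intro h δ hδ
    obtain ⟨F, hF, hnear, hfloor⟩ := h δ hδ
    refine ⟨vals F, ⟨F, hF, rfl⟩, ?_, hfloor⟩
    rintro w ⟨G, hG, rfl⟩
    exact hnear G hG

/-- **`LaserMergeOptimal ⟺ LaserTightAtTopW V`** (residual of record 27897, via `LaserCutIsSpectral`). -/
theorem laserMergeOptimal_iff_world :
    Theses.OutsiderSandwich.LaserMergeOptimal ↔ LaserTightAtTopW valueSet :=
  laserMergeOptimal_iff_tightAtTop.trans laserTightAtTopW_iff.symm

/-! ## 4. The residual chain is strict relative to the laws -/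

/-- **The residual chain and its typed strictness.**  PROVED: `LaserMergeOptimal ⟹
CouplingMergeOptimal ⟹ BlockOneMergeOptimal`; the true value set obeys L1–L9 and the letters there are
the items; and there are law-abiding worlds with `BlockOneMergeOptimal ∧ ¬CouplingMergeOptimal ∧
¬LaserTightAtTop ∧ ¬(ω = 2)` and with `CouplingMergeOptimal ∧ ¬LaserTightAtTop ∧ ¬(ω = 2)`. -/
theorem residual_chain_strict :
    (Theses.OutsiderSandwich.LaserMergeOptimal → Theses.OutsiderSandwich.CouplingMergeOptimal) ∧
    (Theses.OutsiderSandwich.CouplingMergeOptimal → Theses.OutsiderSandwich.BlockOneMergeOptimal) ∧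
    Laws valueSet ∧
    (BlockOneMergeOptimalW valueSet ↔ Theses.OutsiderSandwich.BlockOneMergeOptimal) ∧
    (CouplingMergeOptimalW valueSet ↔ Theses.OutsiderSandwich.CouplingMergeOptimal) ∧
    (LaserTightAtTopW valueSet ↔ Theses.OutsiderSandwich.LaserMergeOptimal) ∧
    (SummitW valueSet ↔ _root_.MatrixMultiplication) ∧
    (∃ X : Set Pt, Laws X ∧ BlockOneMergeOptimalW X ∧ ¬ CouplingMergeOptimalW X ∧
      ¬ LaserTightAtTopW X ∧ ¬ SummitW X) ∧
    (∃ X : Set Pt, Laws X ∧ CouplingMergeOptimalW X ∧ ¬ LaserTightAtTopW X ∧ ¬ SummitW X) :=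
  ⟨OutsiderSandwichSquaredLaserPacking.couplingMergeOptimal_of_laserMergeOptimal,
    fun h => OutsiderSandwichBlockOneItems.blockOneMergeOptimal_iff.2
      (OutsiderSandwichBlockOne.blockMergeOptimal_iff_one.1
        (OutsiderSandwichBlock.blockMergeOptimal_of_couplingMergeOptimal
          (OutsiderSandwichCouplingItems.couplingMergeOptimal_iff.1 h))),
    laws_valueSet, blockOneMergeOptimalW_iff, couplingMergeOptimalW_iff,
    laserTightAtTopW_iff.trans laserMergeOptimal_iff_tightAtTop.symm, summitW_iff, worldOne, worldTwo⟩

end Summit.MatrixMultiplication.MatrixMultiplication.Theorems.OutsiderSandwichBlockOneWorldsFaithful
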